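import Summits.Parity.GeneralizedHardyLittlewood.Theorems.LeeYangFibresAbsoluteUpgradeDefs
import Summits.Parity.GeneralizedHardyLittlewood.Theorems.LeeYangFibresAbsoluteUpgradeSinglesDecaySeq
import Summits.Parity.GeneralizedHardyLittlewood.Theorems.LeeYangFibresAbsoluteUpgradeSinglesDecayLocal
import HarnessLib

/-!
# Route `LeeYangFibres`, crux `PrimeCellsRelative` (stmt-Parity-14112): vocabulary of the line
# `SketchIdeator4` (card `sieve-out-to-chowla`)

Route-posited objects and STATEMENTS (D-0016 `<Route><Crux>Defs` file) shared by the registered stubs of the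
skeleton `Cruxes/PrimeCellsRelative/Lines/SketchIdeator4.lean` (line lead `prover-line-stmt-Parity-14112-a1-0`,
2026-08-16) and by the files that prove and compose them.  Nothing is asserted: every `def … : Prop` below is a
statement (the TYPE of a registered stub, or of a hypothesis of one), consumed only as such.

The line (one paragraph).  The joint `N^{1/u}`-rough tuples of a `d = 1` system `Ψ` are the disjoint union of the
route's `Ω`-cells `C_j`, `j ∈ [1,u]^t`, and `λ(ψ_i(n)) = (−1)^{Ω(ψ_i(n))} = (−1)^{j_i}` is CONSTANT on a cell; so for
every `S ⊆ [t]` the rough-restricted correlation `E_S = Σ_{n rough} ∏_{i∈S} λ(ψ_i(n))` is the signed cell sum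
`Σ_j (∏_{i∈S}(−1)^{j_i}) C_j`, and Walsh inversion of the route's `CellParityLaw` (crux 3) gives
`|θ_S|·M Â^t ≤ |E_S| + 2^{t+1}|Ã| Â^{t−1} M + u^t E` (`WalshExtraction`; `M = β_∞ ∏β_p`, `Â = Φ(N,N^{1/u})/N`,
`Ã` the alternating cell sum, `→ 0` relatively by `ModelCellFacts`).  Sieving OUT (sign split + two applications of
the Fundamental Lemma in dimension `t` at level `z^s`, main terms cancel: the `|S| = 1` instance is the sibling crux's
landed `signed_sifted_sum_le`) bounds `|E_S|` by `C e^{-s} M (u/log N)^t` plus class sums of the sign along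
progressions of squarefree modulus `≤ N^{2s/u}` (`SieveTransfer`, any `±1`-valued weight).  For `|S| = 1` the class
sums are small by Bombieri–Vinogradov for `λ` (sibling crux's landed `classSums_le`: `SingletonClassSums`); for
`|S| ≥ 2` their smallness is the line's one new, conjecture-grade input `LiouvilleTupleMean` (a Bombieri–Vinogradov
MEAN VALUE for `|S|`-point Liouville correlations along the system at level `N^η`, natural density — no primes in it),
turned into the weighted root-class form by Cauchy–Schwarz (`WeightedTupleClassSums`).  With `RoughAnatomy`
(`Â ≥ c u/log N`, landed) every loss is a constant killed by choosing `s`, then `u`, then `ε_law`, then `N₀`, and the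
prime cell `C_𝟙 = (Σ_S θ_S) M a₁^t ± E` follows with the crux's relative + absolute error: `PrimeCellsRelative`.

Objects: `tupleSign`, `roughCorrelation`, `classSum`, `rootClassSums` (over the sibling line's landed vocabulary
`NlcCellsAbsoluteClip.roughTuples / jointCell / walshForm / modelCell / roughCell` and `Theorems.AbsoluteUpgrade.sysPoly /
rootsMod`, which are REUSED, not redeclared).  Statements: `LiouvilleTupleMean` (conjectural input),
`WeightedTupleClassSums`, `SingletonClassSums`, `SieveTransfer`, `WalshExtraction` (provable glue).

References: Green–Tao 2010 §1 [GreenTao2010] (normalisations); Friedlander–Iwaniec, Opera de Cribro, Cor. 6.10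
[FriedlanderIwaniecOpera2010] (fundamental lemma); Halberstam–Richert 1974 §5.7 [HalberstamRichert1974]
(`k^{ω(d)}` weights); Iwaniec–Kowalski 2004 Thm 17.4 [IwaniecKowalski2004] (Bombieri–Vinogradov for `λ`);
Chowla 1965 / Tao 2016 [TaoFMP2016] (the species of `LiouvilleTupleMean`).
-/

noncomputable section

open scoped BigOperators Classical
open Finset Filter

namespace Summit.Parity.GeneralizedHardyLittlewood.Cruxes.PrimeCellsRelative.SieveOutToChowla

open Literature.NumberTheory.Sieve
open Summit.Parity.GeneralizedHardyLittlewood.Theses.LeeYangFibres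
open Summit.Parity.GeneralizedHardyLittlewood.Cruxes.AbsoluteUpgrade.NlcCellsAbsoluteClip
  (roughTuples jointCell walshForm modelCell roughCell)
open Summit.Parity.GeneralizedHardyLittlewood.Theorems.AbsoluteUpgrade (sysPoly rootsMod)

/-! ## Objects -/

/-- The tuple sign `σ_S(m) = ∏_{i ∈ S} (−1)^{Ω(ψ_i(m))}` of a one-dimensional system at the integer `m`
(`= ∏_{i∈S} λ(ψ_i(m))` when every `ψ_i(m) ≥ 1`; junk-free: a non-positive value has `toNat = 0`, `Ω(0) = 0`,
sign `+1`).  Always `±1`. [folklore] -/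
def tupleSign {t : ℕ} (Ψ : Fin t → AffLinForm 1) (S : Finset (Fin t)) (m : ℤ) : ℝ :=
  ∏ i ∈ S, (-1 : ℝ) ^ (ArithmeticFunction.cardFactors (((Ψ i).eval (fun _ => m)).toNat))

/-- The rough-restricted `|S|`-point correlation `E_S(Ψ, K, N, u) = Σ_{n ∈ roughTuples} σ_S(n₀)` — the signed
sum of ALL joint rough cells, `Σ_{j ∈ [1,u]^t} (∏_{i∈S}(−1)^{j_i}) C_j`, once `N^{1/u} ≥ max(2, 2L)`. [folklore] -/
def roughCorrelation {t : ℕ} (Ψ : Fin t → AffLinForm 1) (K : Set (Fin 1 → ℝ)) (N u : ℕ)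
    (S : Finset (Fin t)) : ℝ :=
  ∑ n ∈ roughTuples Ψ K N u, tupleSign Ψ S (n 0)

/-- The class sum `F_S([m₁,m₂]; d, r) = Σ_{m ∈ [m₁,m₂], m ≡ r (d)} σ_S(m)` — a plain `|S|`-point Chowla-type sum
along the progression `r mod d` of an integer interval (no roughness, no primes). [folklore] -/
def classSum {t : ℕ} (Ψ : Fin t → AffLinForm 1) (S : Finset (Fin t)) (m₁ m₂ : ℤ) (d : ℕ) (r : ℤ) : ℝ :=
  ∑ m ∈ (Finset.Icc m₁ m₂).filter (fun m : ℤ => m ≡ r [ZMOD d]), tupleSign Ψ S m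

/-- The root-class sums up to level `D`:
`Σ_{d ≤ D squarefree} Σ_{s mod d, d ∣ F_Ψ(s)} |F_S([m₁,m₂]; d, s)|`, `F_Ψ = ∏_k (a_k X + b_k)` — exactly the
remainder functional produced by the sieve transfer. [folklore] -/
def rootClassSums {t : ℕ} (Ψ : Fin t → AffLinForm 1) (S : Finset (Fin t)) (m₁ m₂ : ℤ) (D : ℕ) : ℝ :=
  ∑ d ∈ (Finset.Icc 1 D).filter Squarefree, ∑ s ∈ rootsMod (sysPoly Ψ) d, |classSum Ψ S m₁ m₂ d (s : ℤ)|

/-! ## Statements (types of the registered stubs; nothing is asserted) -/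

/-- **The parity input (conjecture-grade; the line's one new hypothesis).** `LiouvilleTupleMean t`: a
Bombieri–Vinogradov MEAN-VALUE bound for `k`-point Liouville correlations (`2 ≤ k = |S| ≤ t`) along the
sub-systems of a non-degenerate one-dimensional system of size `≤ L`: for every `L` and every `A` there are a level
exponent `η > 0`, `C` and `N₀` with
`Σ_{d ≤ N^η squarefree} |Σ_{m ∈ I, m ≡ r_d (d)} ∏_{i∈S} λ(ψ_i(m))| ≤ C N/(log N)^A`
for all `N ≥ N₀`, all integer intervals `I ⊆ [−N, N]`, all `S` with `|S| ≥ 2` and EVERY choice of residues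
`r : ℕ → ℤ` (i.e. the worst class per modulus).  Natural density, shifts `≤ LN`, level `N^η` for one `η = η(L, A)`;
nothing about primes.  Vacuous (true) for `t ≤ 1`.  Open: known engines give `2`-point Chowla only with logarithmic
averaging (Tao 2016; Helfgott–Radziwiłł 2021; Pilatte) — line statement, NOT a literature fact; candidate route item
(an alternative to the zero-locus crux `FibreHyperbolicity`); sources of the species: Chowla 1965, Tao 2016,
Tao–Teräväinen 2019. -/
def LiouvilleTupleMean (t : ℕ) : Prop :=
  ∀ L : ℕ, ∀ A : ℝ, ∃ η : ℝ, 0 < η ∧ ∃ C : ℝ, ∃ N₀ : ℕ, ∀ N : ℕ, N₀ ≤ N →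
    ∀ Ψ : Fin t → AffLinForm 1, IsNondegenerateSystem Ψ → affLinSize Ψ N ≤ L →
    ∀ m₁ m₂ : ℤ, Finset.Icc m₁ m₂ ⊆ Finset.Icc (-(N : ℤ)) N →
    ∀ S : Finset (Fin t), 2 ≤ S.card → ∀ r : ℕ → ℤ,
      ∑ d ∈ (Finset.Icc 1 ⌊(N : ℝ) ^ η⌋₊).filter Squarefree, |classSum Ψ S m₁ m₂ d (r d)| ≤
        C * N / Real.log N ^ A

/-- **Weighted form of the parity input (provable from `LiouvilleTupleMean t` by Cauchy–Schwarz).** The root-class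
sums of every `S` with `|S| ≥ 2` up to level `N^η` are `≤ C N/(log N)^{t+1}`: per modulus keep the worst of the
`ω_F(d) ≤ (L+t)^{ω(d)}` classes, `Σ_d ω_F(d) M_d ≤ (Σ_d ω_F(d)² M_d)^{1/2} (Σ_d M_d)^{1/2}` with the trivial
`M_d ≤ #I/d + 1` and `Σ_{d ≤ D} B^{2ω(d)}/d ≪ (log D)^{2B²}` (sibling line: `sum_pow_omega_div_le`) on the first
factor and `LiouvilleTupleMean` with `A = 2(L+t)² + 2t + 4` on the second.  Line statement (type of the conclusion
of the registered stub `stub_weightedFromMean`); source of the weights: Halberstam–Richert 1974 §5.7. -/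
def WeightedTupleClassSums (t : ℕ) : Prop :=
  ∀ L : ℕ, ∃ η : ℝ, 0 < η ∧ ∃ C : ℝ, ∃ N₀ : ℕ, ∀ N : ℕ, N₀ ≤ N →
    ∀ Ψ : Fin t → AffLinForm 1, IsNondegenerateSystem Ψ → affLinSize Ψ N ≤ L →
    ∀ m₁ m₂ : ℤ, Finset.Icc m₁ m₂ ⊆ Finset.Icc (-(N : ℤ)) N →
    ∀ S : Finset (Fin t), 2 ≤ S.card →
      rootClassSums Ψ S m₁ m₂ ⌊(N : ℝ) ^ η⌋₊ ≤ C * N / Real.log N ^ (t + 1)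

/-- **The `|S| = 1` class sums are small (a THEOREM: Bombieri–Vinogradov for `λ`).** For a form of the system that
is `≥ 1` on the integer interval `I ⊆ [−N, N]`, the root-class sums of `S = {i}` up to level `N^{1/8}` are
`≤ C N/(log N)^{t+1}` — the sibling line's landed `classSums_le` (values `≤ 2LN`, moduli `|a_i| d ≤ (2LN)^{1/4}`,
root counts `ω_F(p) ≤ L + t`).  Line statement (type of the registered stub `stub_singletonClassSums`); source of
the engine: Iwaniec–Kowalski 2004 Thm 17.4 (Bombieri–Vinogradov for `λ`). -/
def SingletonClassSums : Prop :=
  ∀ (t L : ℕ), ∃ C : ℝ, 0 ≤ C ∧ ∃ N₀ : ℕ, ∀ N : ℕ, N₀ ≤ N →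
    ∀ Ψ : Fin t → AffLinForm 1, IsNondegenerateSystem Ψ → affLinSize Ψ N ≤ L →
    ∀ m₁ m₂ : ℤ, Finset.Icc m₁ m₂ ⊆ Finset.Icc (-(N : ℤ)) N →
      (∀ m ∈ Finset.Icc m₁ m₂, ∀ k, 1 ≤ (Ψ k).eval (fun _ => m)) →
    ∀ i : Fin t,
      rootClassSums Ψ {i} m₁ m₂ ⌊(N : ℝ) ^ ((1 : ℝ) / 8)⌋₊ ≤ C * N / Real.log N ^ (t + 1)

/-- **The sieve transfer (sieving OUT a signed sequence; provable now).** For every `t, L` there is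
`C = C(t, L) ≥ 0` such that for all `s ≥ 1`, all `u ≥ 4s` and `N ≥ N₀(t, L, s, u)`: for every non-degenerate
`Ψ` of size `≤ L`, every convex `K ⊆ [−N, N]` and EVERY `±1`-valued weight `σ` on `ℤ`, the lattice points of
`K ∩ {Ψ ≥ 1}` form an integer interval `[m₁, m₂] ⊆ [−N, N]` and
`|Σ_{n ∈ roughTuples} σ(n₀)| ≤ C e^{−s} · β_∞∏β_p · (u/log N)^t
   + Σ_{d ≤ N^{2s/u} sqfree} Σ_{r mod d, d ∣ F_Ψ(r)} |Σ_{m ∈ [m₁,m₂], m ≡ r (d)} σ(m)| + N/(log N)^{t+1}`.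
Proof route: off the local obstructions (else there are no rough tuples) split by the sign of `σ` into two
non-negative value sequences of `F_Ψ = ∏_k ψ_k` with the SAME size `#I/2` and density `ω_F(m)/m` (dimension
`2(L+t)`, sibling line: `hasSieveDimension_sysPoly`), apply the tree's two-sided Fundamental Lemma
(`SieveSequence.fundamental_lemma_uniform_holds`) at `z = ⌊N^{1/u}⌋ + 1`, `D = z^s` to both — the main terms
`X V(z)` CANCEL —, bound `#I V(z) ≤ (β_∞ + 1) · 2∏β_p (u/log N)^t`, and collect the `O(1)`-per-class boundary
terms, the `≤ t` points with some `ψ_k = 1` and `Σ_{d ≤ N^{1/2}} (L+t)^{ω(d)}` into `N/(log N)^{t+1}`.  Line statement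
(type of the registered stub `stub_sieveTransfer`); source of the engine: Friedlander–Iwaniec, Opera de Cribro,
Cor. 6.10. -/
def SieveTransfer : Prop :=
  ∀ (t L : ℕ), ∃ C : ℝ, 0 ≤ C ∧ ∀ s : ℝ, 1 ≤ s → ∀ u : ℕ, 4 * s ≤ (u : ℝ) → ∃ N₀ : ℕ, ∀ N : ℕ, N₀ ≤ N →
    ∀ Ψ : Fin t → AffLinForm 1, IsNondegenerateSystem Ψ → affLinSize Ψ N ≤ L →
    ∀ K : Set (Fin 1 → ℝ), Convex ℝ K → K ⊆ realBox 1 N →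
    ∀ σ : ℤ → ℝ, (∀ m, σ m = 1 ∨ σ m = -1) →
      ∃ m₁ m₂ : ℤ, Finset.Icc m₁ m₂ ⊆ Finset.Icc (-(N : ℤ)) N ∧
        (∀ m ∈ Finset.Icc m₁ m₂, ∀ k, 1 ≤ (Ψ k).eval (fun _ => m)) ∧
        |∑ n ∈ roughTuples Ψ K N u, σ (n 0)| ≤
          C * Real.exp (-s) * (archFactor Ψ K * singularProduct Ψ) * ((u : ℝ) / Real.log N) ^ t +
            ∑ d ∈ (Finset.Icc 1 ⌊(N : ℝ) ^ (2 * s / u)⌋₊).filter Squarefree,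
              ∑ r ∈ rootsMod (sysPoly Ψ) d,
                |∑ m ∈ (Finset.Icc m₁ m₂).filter (fun m : ℤ => m ≡ (r : ℤ) [ZMOD d]), σ m| +
            (N : ℝ) / Real.log N ^ (t + 1)

/-- **Walsh extraction (provable now): under the law, `θ_S` IS `E_S`.**  If the joint cells are `E`-close to the
Walsh model `Θ_θ(j) · β_∞∏β_p · ∏_i A_{j_i}/N` on `[1,u]^t` (`|θ_T| ≤ 2`) and `N^{1/u} ≥ max(2, 2L)` (so that the
rough tuples are the disjoint union of the cells `j ∈ [1,u]^t`, sibling line: `cellIndex_mem_piFinset`), then for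
every `S ⊆ [t]`
`|θ_S| · M Â^t ≤ |E_S| + 2^{t+1} |Ã| Â^{t−1} M + u^t E`
(`M = β_∞∏β_p`, `Â = Σ_{m ≤ u} A_m/N`, `Ã = Σ_{m ≤ u} (−1)^m A_m/N`): expanding, `Σ_j ∏_{i∈S}(−1)^{j_i} Θ_θ(j)
∏_k a_{j_k} = Σ_T θ_T ∏_k f_{T,k}` with `f_{T,k} ∈ {±Â, ±Ã}`, the factor `Ã` occurring exactly for `k ∈ S Δ T`;
the `T = S` term is `(−1)^{|S|} θ_S Â^t`, each other term is at most `2|Ã| Â^{t−1}` (the `S = {i}` case is the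
sibling line's landed `abs_theta_singleton_mul_pow_le`).  Line statement (type of the registered stub
`stub_walshExtraction`). -/
def WalshExtraction : Prop :=
  ∀ (t : ℕ) (Ψ : Fin t → AffLinForm 1) (K : Set (Fin 1 → ℝ)) (N u L : ℕ), IsNondegenerateSystem Ψ →
    1 ≤ N → 1 ≤ u → affLinSize Ψ N ≤ L → (2 : ℝ) ≤ (N : ℝ) ^ ((1 : ℝ) / u) →
    (2 * L : ℝ) ≤ (N : ℝ) ^ ((1 : ℝ) / u) →
    ∀ (θ : Finset (Fin t) → ℝ), (∀ T, |θ T| ≤ 2) → ∀ E : ℝ,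
    (∀ j : Fin t → ℕ, (∀ i, 1 ≤ j i ∧ j i ≤ u) →
        |(jointCell Ψ K N u j : ℝ) - walshForm θ j * modelCell Ψ K N u j| ≤ E) →
    ∀ S : Finset (Fin t),
      |θ S| * (archFactor Ψ K * singularProduct Ψ) * (∑ m ∈ Finset.Icc 1 u, (roughCell N u m : ℝ) / N) ^ t ≤
        |roughCorrelation Ψ K N u S| +
          2 ^ (t + 1) * |∑ m ∈ Finset.Icc 1 u, (-1 : ℝ) ^ m * ((roughCell N u m : ℝ) / N)| *
            (∑ m ∈ Finset.Icc 1 u, (roughCell N u m : ℝ) / N) ^ (t - 1) *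
            (archFactor Ψ K * singularProduct Ψ) +
          (u : ℝ) ^ t * E

/-! ## Sanity (proved) -/

/-- The tuple sign is `±1`. [folklore] -/
theorem tupleSign_eq_one_or {t : ℕ} (Ψ : Fin t → AffLinForm 1) (S : Finset (Fin t)) (m : ℤ) :
    tupleSign Ψ S m = 1 ∨ tupleSign Ψ S m = -1 := by
  unfold tupleSign
  induction S using Finset.induction_on with
  | empty => simp
  | insert i S hi ih =>
    rw [Finset.prod_insert hi]
    rcases neg_one_pow_eq_or ℝ (ArithmeticFunction.cardFactors (((Ψ i).eval (fun _ => m)).toNat)) with h | h <;>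
      rcases ih with h' | h' <;> simp [h, h']

/-- `|σ_S(m)| = 1`. [folklore] -/
theorem abs_tupleSign {t : ℕ} (Ψ : Fin t → AffLinForm 1) (S : Finset (Fin t)) (m : ℤ) :
    |tupleSign Ψ S m| = 1 := by
  rcases tupleSign_eq_one_or Ψ S m with h | h <;> simp [h]

/-- The root-class sums are the sieve transfer's remainder functional at `σ = σ_S` (definitional). [folklore] -/
theorem rootClassSums_eq {t : ℕ} (Ψ : Fin t → AffLinForm 1) (S : Finset (Fin t)) (m₁ m₂ : ℤ) (D : ℕ) :
    rootClassSums Ψ S m₁ m₂ D =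
      ∑ d ∈ (Finset.Icc 1 D).filter Squarefree, ∑ r ∈ rootsMod (sysPoly Ψ) d,
        |∑ m ∈ (Finset.Icc m₁ m₂).filter (fun m : ℤ => m ≡ (r : ℤ) [ZMOD d]), tupleSign Ψ S m| := rfl

/-- `LiouvilleTupleMean t` is vacuous for `t ≤ 1` (no `S ⊆ Fin t` has two elements). [folklore] -/
theorem liouvilleTupleMean_of_le_one {t : ℕ} (ht : t ≤ 1) : LiouvilleTupleMean t := by
  intro L A
  refine ⟨1, one_pos, 0, 0, fun N _ Ψ _ _ m₁ m₂ _ S hS r => ?_⟩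
  have : S.card ≤ 1 := (Finset.card_le_univ S).trans (by simpa using ht)
  omega

/-! ## Statements, second pass (2026-08-16, lead a1-0): the parity input needs POSITIVE forms

As typed above, `LiouvilleTupleMean t` and `WeightedTupleClassSums t` quantify over ALL integer intervals
`I ⊆ [−N, N]`, including intervals on which the forms of `S` are NEGATIVE; there `tupleSign Ψ S ≡ +1` (a non-positive value
has `toNat = 0`, sign `+1`), the class sums are `≍ #I/d` with no cancellation, and the `d`-sum is `≍ #I log N^η` — so for
`t ≥ 2` both statements are FALSE (witness: `Ψ = (−X − 1, −2X − 1)`, `I = [0, N]`, `S = {0, 1}`, `r ≡ 0`; recorded by the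
line lead, see `Cruxes/PrimeCellsRelative/Lines/SketchIdeator4.md`), and the landed implications consuming them
(`stub_weightedFromMean`, `stub_chowlaClipsParity`) have a vacuous premise at `t ≥ 2`.  The sieve transfer only ever
produces intervals on which EVERY form is `≥ 1` (`SieveTransfer`'s conclusion says so); the corrected statements below add
exactly that hypothesis (as `SingletonClassSums` already had) and replace the two above in the line's composition. -/

/-- **The parity input, corrected (conjecture-grade; the line's one new hypothesis).** `LiouvilleTupleMeanPos t`:
`LiouvilleTupleMean t` restricted to integer intervals `I ⊆ [−N, N]` on which every form of the system is `≥ 1`, so that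
`∏_{i∈S} (−1)^{Ω(ψ_i(m))} = ∏_{i∈S} λ(ψ_i(m))` is a genuine `|S|`-point Liouville correlation of pairwise non-proportional
forms: for every `L` and `A` there are `η > 0`, `C`, `N₀` with `Σ_{d ≤ N^η sqfree} |Σ_{m ∈ I, m ≡ r_d (d)} ∏_{i∈S} λ(ψ_i(m))|
≤ C N/(log N)^A` for all `N ≥ N₀`, all such `I`, all `S` with `|S| ≥ 2` and every choice of residues `r`.  Natural density,
shifts `≤ LN`, level `N^η`; nothing about primes; vacuous for `t ≤ 1`.  Open (log-averaged `k = 2` is Tao 2016) — line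
statement, NOT a literature fact; candidate route item (an alternative to the zero-locus crux `FibreHyperbolicity`). -/
def LiouvilleTupleMeanPos (t : ℕ) : Prop :=
  ∀ L : ℕ, ∀ A : ℝ, ∃ η : ℝ, 0 < η ∧ ∃ C : ℝ, ∃ N₀ : ℕ, ∀ N : ℕ, N₀ ≤ N →
    ∀ Ψ : Fin t → AffLinForm 1, IsNondegenerateSystem Ψ → affLinSize Ψ N ≤ L →
    ∀ m₁ m₂ : ℤ, Finset.Icc m₁ m₂ ⊆ Finset.Icc (-(N : ℤ)) N →
      (∀ m ∈ Finset.Icc m₁ m₂, ∀ k, 1 ≤ (Ψ k).eval (fun _ => m)) →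
    ∀ S : Finset (Fin t), 2 ≤ S.card → ∀ r : ℕ → ℤ,
      ∑ d ∈ (Finset.Icc 1 ⌊(N : ℝ) ^ η⌋₊).filter Squarefree, |classSum Ψ S m₁ m₂ d (r d)| ≤
        C * N / Real.log N ^ A

/-- **Weighted form of the corrected parity input (provable from `LiouvilleTupleMeanPos t` by Cauchy–Schwarz, exactly as
`stub_weightedFromMean` proves the uncorrected implication).** On intervals where every form is `≥ 1`, the root-class sums
of every `S` with `|S| ≥ 2` up to level `N^η` are `≤ C N/(log N)^{t+1}`.  Line statement (type of the conclusion of the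
registered stub `stub_weightedFromMeanPos`). -/
def WeightedTupleClassSumsPos (t : ℕ) : Prop :=
  ∀ L : ℕ, ∃ η : ℝ, 0 < η ∧ ∃ C : ℝ, ∃ N₀ : ℕ, ∀ N : ℕ, N₀ ≤ N →
    ∀ Ψ : Fin t → AffLinForm 1, IsNondegenerateSystem Ψ → affLinSize Ψ N ≤ L →
    ∀ m₁ m₂ : ℤ, Finset.Icc m₁ m₂ ⊆ Finset.Icc (-(N : ℤ)) N →
      (∀ m ∈ Finset.Icc m₁ m₂, ∀ k, 1 ≤ (Ψ k).eval (fun _ => m)) →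
    ∀ S : Finset (Fin t), 2 ≤ S.card →
      rootClassSums Ψ S m₁ m₂ ⌊(N : ℝ) ^ η⌋₊ ≤ C * N / Real.log N ^ (t + 1)

/-- `LiouvilleTupleMeanPos t` is vacuous for `t ≤ 1` (no `S ⊆ Fin t` has two elements). [folklore] -/
theorem liouvilleTupleMeanPos_of_le_one {t : ℕ} (ht : t ≤ 1) : LiouvilleTupleMeanPos t := by
  intro L A
  refine ⟨1, one_pos, 0, 0, fun N _ Ψ _ _ m₁ m₂ _ _ S hS r => ?_⟩
  have : S.card ≤ 1 := (Finset.card_le_univ S).trans (by simpa using ht)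
  omega

/-- The unrestricted statement implies the corrected one (drop the positivity hypothesis). [folklore] -/
theorem liouvilleTupleMeanPos_of_liouvilleTupleMean {t : ℕ} (h : LiouvilleTupleMean t) :
    LiouvilleTupleMeanPos t := by
  intro L A
  obtain ⟨η, hη, C, N₀, hN₀⟩ := h L A
  exact ⟨η, hη, C, N₀, fun N hN Ψ hΨ hL m₁ m₂ hI _ S hS r => hN₀ N hN Ψ hΨ hL m₁ m₂ hI S hS r⟩

/-- The unrestricted weighted statement implies the corrected one. [folklore] -/
theorem weightedTupleClassSumsPos_of_weightedTupleClassSums {t : ℕ} (h : WeightedTupleClassSums t) :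
    WeightedTupleClassSumsPos t := by
  intro L
  obtain ⟨η, hη, C, N₀, hN₀⟩ := h L
  exact ⟨η, hη, C, N₀, fun N hN Ψ hΨ hL m₁ m₂ hI _ S hS => hN₀ N hN Ψ hΨ hL m₁ m₂ hI S hS⟩

/-! ## The composition statement (so that exactly one theorem of the skeleton concludes the crux) -/

open Summit.Parity.GeneralizedHardyLittlewood.Cruxes.AbsoluteUpgrade.NlcCellsAbsoluteClip (RoughAnatomy) in
/-- **The line's composition statement** (type of the registered stub `stub_chowlaClipsParityPos`): the five provable
inputs, the rough anatomy, the model cell facts and the route's crux 3 imply the crux.  Line statement. -/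
def ChowlaClipsParityPos : Prop :=
  SieveTransfer → WalshExtraction → SingletonClassSums → (∀ t : ℕ, 2 ≤ t → WeightedTupleClassSumsPos t) →
    RoughAnatomy → ModelCellFacts → CellParityLaw → PrimeCellsRelative

open Summit.Parity.GeneralizedHardyLittlewood.Cruxes.AbsoluteUpgrade.NlcCellsAbsoluteClip (RoughAnatomy) in
/-- Unfolding lemma for `ChowlaClipsParityPos` (registered sub-goal `chowlaClipsParityPos_iff`). [folklore] -/
theorem chowlaClipsParityPos_iff : ChowlaClipsParityPos ↔ (SieveTransfer → WalshExtraction → SingletonClassSums → (∀ t : ℕ, 2 ≤ t → WeightedTupleClassSumsPos t) → RoughAnatomy → ModelCellFacts → CellParityLaw → PrimeCellsRelative) :=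
  Iff.rfl

/-! ## Statements, third pass (2026-08-16, lead c6-0): the crux and the law SLICED at a fixed number of forms

The line's composition uses the route's `CellParityLaw` and the parity input only at the number of forms `t` of the
system at hand (`stub_chowlaClipsParityPos` fixes `t` before choosing any constant).  So the line theorem localises:
`CellParityLawAt t → LiouvilleTupleMeanPos t → PrimeCellsRelativeAt t` for every `t ≥ 1` (registered sub-goal
`primeCellsRelativeAt_of_cellParityLawAt`), and the PAIR content of the crux (`t = 2`: twins, Sophie Germain, binary
Goldbach to relative accuracy) needs only the pair law and the 2-point input `LiouvilleTupleMeanPos 2`.  The two slices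
below are the bodies of the route declarations `LeeYangFibres.CellParityLaw` / `LeeYangFibres.PrimeCellsRelative` at a
fixed `t`, VERBATIM (the conjunction over `t ≥ 1` recovers each route declaration: `cellParityLaw_iff_forall_at`,
`primeCellsRelative_iff_forall_at`).  Nothing is asserted. -/

/-- **The route's crux 3 at `t` forms** (`CellParityLawAt t`): the body of `LeeYangFibres.CellParityLaw` at a fixed
number of forms — for all `L`, `u ≥ 2`, `ε > 0`, eventually in `N`, every non-degenerate `Ψ : Fin t → AffLinForm 1` with
`‖Ψ‖_N ≤ L` and every convex `K ⊆ [−N, N]` admit Walsh amplitudes `θ` (`θ_∅ = 1`, `|θ_S| ≤ 2`) modelling every joint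
rough cell `j ∈ [1,u]^t` up to `ε N / log^t N`.  Line statement (a slice of a route declaration, not a new claim).
[cite: BombieriAsymptoticSieve1976] -/
def CellParityLawAt (t : ℕ) : Prop :=
  ∀ (L u : ℕ), 2 ≤ u → ∀ ε : ℝ, 0 < ε → ∃ N₀ : ℕ, ∀ N : ℕ, N₀ ≤ N → ∀ Ψ : Fin t → Literature.NumberTheory.Sieve.AffLinForm 1, Literature.NumberTheory.Sieve.IsNondegenerateSystem Ψ → Literature.NumberTheory.Sieve.affLinSize Ψ N ≤ L → ∀ K : Set (Fin 1 → ℝ), Convex ℝ K → K ⊆ Literature.NumberTheory.Sieve.realBox 1 N → ∃ θ : Finset (Fin t) → ℝ, θ ∅ = 1 ∧ (∀ S, |θ S| ≤ 2) ∧ ∀ j : Fin t → ℕ, (∀ i, 1 ≤ j i ∧ j i ≤ u) → |((((Literature.NumberTheory.Sieve.latticeBox 1 N).filter (fun n => Literature.NumberTheory.Sieve.realPoint n ∈ K ∧ ∀ i, (N : ℝ) ^ ((1 : ℝ) / u) < (Nat.minFac ((Ψ i).eval n).toNat : ℝ) ∧ ArithmeticFunction.cardFactors ((Ψ i).eval n).toNat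 = j i)).card : ℕ) : ℝ) - (∑ S : Finset (Fin t), θ S * ∏ i ∈ S, (-1 : ℝ) ^ (j i + 1)) * (Literature.NumberTheory.Sieve.archFactor Ψ K * Literature.NumberTheory.Sieve.singularProduct Ψ * ∏ i, ((((Finset.Icc 1 N).filter (fun m => (N : ℝ) ^ ((1 : ℝ) / u) < (Nat.minFac m : ℝ) ∧ ArithmeticFunction.cardFactors m = j i)).card : ℕ) : ℝ) / N)| ≤ ε * N / Real.log N ^ t

/-- **The crux at `t` forms** (`PrimeCellsRelativeAt t`): the body of `LeeYangFibres.PrimeCellsRelative` at a fixed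
number of forms — the counting Dickson–Hardy–Littlewood law for the joint rough prime cell of `t` forms with Green–Tao's
relative + absolute error.  `t = 1`: a theorem (`Sketch.primeCellsRelative_at_one`); `t = 2`: the pair content
(twins, Sophie Germain, binary Goldbach to relative accuracy).  Line statement (a slice of the route declaration).
[cite: GreenTao2010, Conj. 1.4] -/
def PrimeCellsRelativeAt (t : ℕ) : Prop :=
  ∀ L : ℕ, ∀ ε : ℝ, 0 < ε → ∃ u : ℕ, 2 ≤ u ∧ ∃ N₀ : ℕ, ∀ N : ℕ, N₀ ≤ N → ∀ Ψ : Fin t → Literature.NumberTheory.Sieve.AffLinForm 1, Literature.NumberTheory.Sieve.IsNondegenerateSystem Ψ → Literature.NumberTheory.Sieve.affLinSize Ψ N ≤ L → ∀ K : Set (Fin 1 → ℝ), Convex ℝ K → K ⊆ Literature.NumberTheory.Sieve.realBox 1 N → |((((Literature.NumberTheory.Sieve.latticeBox 1 N).filter (fun n => Literature.NumberTheory.Sieve.realPoint n ∈ K ∧ ∀ i, (N : ℝ) ^ ((1 : ℝ) / u) < (Nat.minFac ((Ψ i).eval n).toNat : ℝ) ∧ ArithmeticFunction.cardFactors ((Ψ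 i).eval n).toNat = 1)).card : ℕ) : ℝ) - Literature.NumberTheory.Sieve.archFactor Ψ K * Literature.NumberTheory.Sieve.singularProduct Ψ * (((((Finset.Icc 1 N).filter (fun m => (N : ℝ) ^ ((1 : ℝ) / u) < (Nat.minFac m : ℝ) ∧ ArithmeticFunction.cardFactors m = 1)).card : ℕ) : ℝ) / N) ^ t| ≤ ε * (Literature.NumberTheory.Sieve.archFactor Ψ K * Literature.NumberTheory.Sieve.singularProduct Ψ * (((((Finset.Icc 1 N).filter (fun m => (N : ℝ) ^ ((1 : ℝ) / u) < (Nat.minFac m : ℝ) ∧ ArithmeticFunction.cardFactors m = 1)).card : ℕ) : ℝ) / N) ^ t + N / Real.log N ^ t)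

/-- The route's crux 3 is the conjunction of its slices over `t ≥ 1` (definitional, up to the order of the binders).
[folklore] -/
theorem cellParityLaw_iff_forall_at : CellParityLaw ↔ ∀ t : ℕ, 1 ≤ t → CellParityLawAt t :=
  ⟨fun h t ht L u hu ε hε => h t L u ht hu ε hε, fun h t L u ht hu ε hε => h t ht L u hu ε hε⟩

/-- The crux is the conjunction of its slices over `t ≥ 1` (definitional, up to the order of the binders).
[folklore] -/
theorem primeCellsRelative_iff_forall_at : PrimeCellsRelative ↔ ∀ t : ℕ, 1 ≤ t → PrimeCellsRelativeAt t :=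
  ⟨fun h t ht L ε hε => h t L ht ε hε, fun h t L ht ε hε => h t ht L ε hε⟩

end Summit.Parity.GeneralizedHardyLittlewood.Cruxes.PrimeCellsRelative.SieveOutToChowla

end
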